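import Mathlib.Analysis.InnerProductSpace.EuclideanDist
import Mathlib.Analysis.Normed.Module.Ball.Homeomorph
import Literature.Topology.FourManifolds.GeneralPosition

/-!
# General position inside the unit ball of `ℝⁿ` (Ancel's Lemma 1 (2), Euclidean form)

Topic `Literature/Topology/FourManifolds` (fact seat
`provefact-Literature.Topology.FourManifolds.nonempty_homeomorph_of_isHCobordant_four`; F3 thread,
towards Freedman's approximation theorem following Ancel 1984).  **Everything in this file is
proved.**

`GeneralPosition.lean` proves Ancel's Lemma 1 (F. D. Ancel, *Approximating cell-like maps of
`S⁴` by homeomorphisms*, Contemp. Math. 35 (1984), §2) for a compact metric space with an open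
set `U` about whose points there are charts `ℝⁿ → S`.  Ancel applies it *"in `Cᵢ - int Dᵢ`"*
(proof of Lemma 3, PDF p. 84), i.e. inside the unit ball `Bⁿ` with homeomorphisms fixing
everything off an open subset of `int Bⁿ`.  This file transports the lemma to that setting: the
ambient space is a finite-dimensional real inner product space `E`, the compact space is the
closed unit ball `B̄(0, 1)` (as a subtype), and the homeomorphisms produced are self-homeomorphisms
of `E` which are the identity off `U ⊆ B(0, 1)`.

## What is formalised (all proved)

* `exists_chart_closedBall` — about every point of the open unit ball there is a chart
  `ℝⁿ → B̄(0, 1)` (`n = dim E`): an open embedding with the point in its range (Mathlib's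
  `OpenPartialHomeomorph.univBall` and `toEuclidean`).
* `isNowhereDense_preimage_val_closedBall` — a nowhere dense subset of `E` pulls back to a nowhere
  dense subset of `B̄(0, 1)`.
* `Homeomorph.extendSubtypeClosedBall` — a self-homeomorphism of `B̄(0, 1)` fixing the unit sphere
  extends by the identity to a self-homeomorphism of `E`.
* **`exists_homeomorph_separated_of_countable_ball`** — Ancel's Lemma 1 (2) in `Bⁿ`: for `U` open,
  `U ⊆ B(0, 1)`, and countable nowhere dense `S, T ⊆ U`, and `ε > 0`, a self-homeomorphism `h` of
  `E`, `ε`-close to the identity, the identity off `U`, with `cl h(S) ∩ T = ∅ = h(S) ∩ cl T`.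

## References

* F. D. Ancel, *Approximating cell-like maps of `S⁴` by homeomorphisms*, in *Four-Manifold
  Theory* (Durham, N.H., 1982), Contemp. Math. **35**, AMS (1984) 143–164, §2 Lemma 1 (2)
  (PDF p. 81), §3 proof of Lemma 3 (PDF p. 84). [Ancel1984]
-/

open Set Function Metric
open scoped Topology

noncomputable section

namespace Literature.Topology.FourManifolds

variable {E : Type*} [NormedAddCommGroup E] [InnerProductSpace ℝ E] [FiniteDimensional ℝ E]

/-- Local notation: `𝔼 n` is the model Euclidean space `EuclideanSpace ℝ (Fin n)`. -/
local notation "𝔼 " n:arg => EuclideanSpace ℝ (Fin n)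

/-! ### §1 Charts of the closed unit ball at interior points -/

/-- **Charts of `B̄(0, 1)` at interior points**: for `x` in the open unit ball there is an open
embedding `ℝⁿ → B̄(0, 1)` (`n = dim E`) with `x` in its range — the affine homeomorphism of `ℝⁿ`
onto a small ball about `x`. [folklore] -/
theorem exists_chart_closedBall {x : E} (hx : x ∈ ball (0 : E) 1) :
    ∃ e : 𝔼 (Module.finrank ℝ E) → closedBall (0 : E) 1,
      Topology.IsOpenEmbedding e ∧ (⟨x, ball_subset_closedBall hx⟩ : closedBall (0 : E) 1) ∈ range
          e := by
  obtain ⟨δ, hδ, hδB⟩ := Metric.mem_nhds_iff.1 (isOpen_ball.mem_nhds hx)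
  set u := OpenPartialHomeomorph.univBall x δ with hu
  have hue : Topology.IsOpenEmbedding u := u.to_isOpenEmbedding
      (OpenPartialHomeomorph.univBall_source x δ)
  have hur : range u = ball x δ := by
    rw [← OpenPartialHomeomorph.univBall_target x hδ, ← u.image_source_eq_target,
      OpenPartialHomeomorph.univBall_source, image_univ]
  set e₀ : 𝔼 (Module.finrank ℝ E) → E := u ∘ (toEuclidean (E := E)).symm with he₀
  have he₀e : Topology.IsOpenEmbedding e₀ :=
    hue.comp (toEuclidean (E := E)).symm.toHomeomorph.isOpenEmbedding
  have he₀r : range e₀ = ball x δ := by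
    rw [he₀, range_comp, (toEuclidean (E := E)).symm.surjective.range_eq, image_univ, hur]
  have hmem : ∀ v, e₀ v ∈ closedBall (0 : E) 1 := fun v =>
    ball_subset_closedBall (hδB (he₀r.subset (mem_range_self v)))
  refine ⟨codRestrict e₀ _ hmem, ⟨he₀e.isEmbedding.codRestrict _ hmem, ?_⟩, ?_⟩
  · have : range (codRestrict e₀ (closedBall (0 : E) 1) hmem) = Subtype.val ⁻¹' ball x δ := by
      ext ⟨y, hy⟩
      simp only [mem_range, mem_preimage, Subtype.ext_iff, val_codRestrict_apply]
      rw [← he₀r, mem_range]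
    rw [this]
    exact isOpen_ball.preimage continuous_subtype_val
  · obtain ⟨v, hv⟩ := he₀r.symm.subset (mem_ball_self hδ)
    exact ⟨v, Subtype.ext hv⟩

/-! ### §2 Nowhere density and closures in the closed ball -/

omit [FiniteDimensional ℝ E] in
/-- A nowhere dense subset of `E` pulls back to a nowhere dense subset of `B̄(0, 1)` (an open set of
the closed ball meets the open ball in an open set of `E`). [folklore] -/
theorem isNowhereDense_preimage_val_closedBall {A : Set E} (hA : IsNowhereDense A) :
    IsNowhereDense (Subtype.val ⁻¹' A : Set (closedBall (0 : E) 1)) := by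
  rw [IsNowhereDense, eq_empty_iff_forall_notMem]
  intro p hp
  rw [mem_interior] at hp
  obtain ⟨O', hO'sub, hO'o, hpO'⟩ := hp
  obtain ⟨O, hO, rfl⟩ := isOpen_induced_iff.1 hO'o
  -- `O ∩ B(0, 1)` is a nonempty open subset of `closure A`
  have hsub : O ∩ ball (0 : E) 1 ⊆ closure A := by
    rintro y ⟨hyO, hyB⟩
    have hy' : (⟨y, ball_subset_closedBall hyB⟩ : closedBall (0 : E) 1) ∈ closure (Subtype.val ⁻¹'
        A) :=
      hO'sub hyO
    rw [closure_subtype] at hy'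
    exact closure_mono (image_preimage_subset _ _) hy'
  have hne : (O ∩ ball (0 : E) 1).Nonempty := by
    -- `p ∈ O` with `‖p‖ ≤ 1`: `p` is a limit of points of the open ball
    have hpcl : (p : E) ∈ closure (ball (0 : E) 1) := by
      rw [closure_ball (0 : E) one_ne_zero]; exact p.2
    obtain ⟨y, hyO, hyB⟩ := mem_closure_iff.1 hpcl O hO hpO'
    exact ⟨y, hyO, hyB⟩
  have : (O ∩ ball (0 : E) 1) ⊆ interior (closure A) := interior_maximal hsub (hO.inter isOpen_ball)
  rw [hA] at this
  exact hne.ne_empty (subset_empty_iff.1 this)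

/-! ### §3 Extending homeomorphisms of the closed ball fixing the sphere -/

/-- The extension by the identity of a self-map of the closed unit ball (auxiliary). [folklore] -/
def extendBallFun (g : closedBall (0 : E) 1 → closedBall (0 : E) 1) (y : E) : E :=
  if hy : ‖y‖ ≤ 1 then (g ⟨y, mem_closedBall_zero_iff.2 hy⟩ : E) else y

omit [InnerProductSpace ℝ E] [FiniteDimensional ℝ E] in
/-- The extension on the closed ball. [folklore] -/
theorem extendBallFun_apply_of_le (g : closedBall (0 : E) 1 → closedBall (0 : E) 1) {y : E}
    (hy : ‖y‖ ≤ 1) : extendBallFun g y = g ⟨y, mem_closedBall_zero_iff.2 hy⟩ := by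
  rw [extendBallFun, dif_pos hy]

omit [InnerProductSpace ℝ E] [FiniteDimensional ℝ E] in
/-- The extension off the closed ball. [folklore] -/
theorem extendBallFun_apply_of_lt (g : closedBall (0 : E) 1 → closedBall (0 : E) 1) {y : E}
    (hy : 1 < ‖y‖) : extendBallFun g y = y := by
  rw [extendBallFun, dif_neg (not_le.2 hy)]

omit [InnerProductSpace ℝ E] [FiniteDimensional ℝ E] in
/-- The extension by the identity of a continuous self-map of the closed ball fixing the sphere is
continuous (pasting along the sphere). [folklore] -/
theorem continuous_extendBallFun {g : closedBall (0 : E) 1 → closedBall (0 : E) 1}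
    (hg : Continuous g) (hfix : ∀ p : closedBall (0 : E) 1, ‖(p : E)‖ = 1 → g p = p) :
    Continuous (extendBallFun g) := by
  have h1 : ContinuousOn (extendBallFun g) (closedBall 0 1) := by
    rw [continuousOn_iff_continuous_restrict]
    have : (closedBall (0 : E) 1).restrict (extendBallFun g) = fun p => (g p : E) := by
      funext p
      rw [restrict_apply, extendBallFun_apply_of_le g (mem_closedBall_zero_iff.1 p.2)]
    rw [this]
    exact continuous_subtype_val.comp hg
  have h2 : ContinuousOn (extendBallFun g) {y | 1 ≤ ‖y‖} := by
    refine continuousOn_id.congr fun y hy => ?_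
    rcases (show 1 ≤ ‖y‖ from hy).eq_or_lt with h | h
    · rw [extendBallFun_apply_of_le g h.symm.le, hfix _ h.symm, id]
    · rw [extendBallFun_apply_of_lt g h, id]
  have hcov : closedBall (0 : E) 1 ∪ {y | 1 ≤ ‖y‖} = univ :=
    eq_univ_of_forall fun y => (le_total ‖y‖ 1).imp mem_closedBall_zero_iff.2 id
  rw [← continuousOn_univ, ← hcov]
  exact h1.union_of_isClosed h2 isClosed_closedBall (isClosed_le continuous_const continuous_norm)

/-- **Extension by the identity**: a self-homeomorphism of `B̄(0, 1)` fixing the unit sphere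
pointwise extends, by the identity off the ball, to a self-homeomorphism of `E`. [folklore] -/
def Homeomorph.extendSubtypeClosedBall (h : closedBall (0 : E) 1 ≃ₜ closedBall (0 : E) 1)
    (hfix : ∀ p : closedBall (0 : E) 1, ‖(p : E)‖ = 1 → h p = p) : E ≃ₜ E where
  toFun := extendBallFun h
  invFun := extendBallFun h.symm
  left_inv y := by
    by_cases hy : ‖y‖ ≤ 1
    · rw [extendBallFun_apply_of_le _ hy,
        extendBallFun_apply_of_le _ (mem_closedBall_zero_iff.1 (h _).2)]
      simp
    · rw [extendBallFun_apply_of_lt _ (not_le.1 hy), extendBallFun_apply_of_lt _ (not_le.1 hy)]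
  right_inv y := by
    by_cases hy : ‖y‖ ≤ 1
    · rw [extendBallFun_apply_of_le _ hy,
        extendBallFun_apply_of_le _ (mem_closedBall_zero_iff.1 (h.symm _).2)]
      simp
    · rw [extendBallFun_apply_of_lt _ (not_le.1 hy), extendBallFun_apply_of_lt _ (not_le.1 hy)]
  continuous_toFun := continuous_extendBallFun h.continuous hfix
  continuous_invFun := continuous_extendBallFun h.symm.continuous fun p hp => by
    rw [Homeomorph.symm_apply_eq]; exact (hfix p hp).symm

omit [InnerProductSpace ℝ E] [FiniteDimensional ℝ E] in
/-- The extension on the closed ball. [folklore] -/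
theorem Homeomorph.extendSubtypeClosedBall_apply_of_mem
    (h : closedBall (0 : E) 1 ≃ₜ closedBall (0 : E) 1)
    (hfix : ∀ p : closedBall (0 : E) 1, ‖(p : E)‖ = 1 → h p = p) {y : E}
    (hy : y ∈ closedBall (0 : E) 1) :
    Homeomorph.extendSubtypeClosedBall h hfix y = h ⟨y, hy⟩ :=
  extendBallFun_apply_of_le h (mem_closedBall_zero_iff.1 hy)

omit [InnerProductSpace ℝ E] [FiniteDimensional ℝ E] in
/-- The extension off the closed ball. [folklore] -/
theorem Homeomorph.extendSubtypeClosedBall_apply_of_not_mem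
    (h : closedBall (0 : E) 1 ≃ₜ closedBall (0 : E) 1)
    (hfix : ∀ p : closedBall (0 : E) 1, ‖(p : E)‖ = 1 → h p = p) {y : E}
    (hy : y ∉ closedBall (0 : E) 1) :
    Homeomorph.extendSubtypeClosedBall h hfix y = y :=
  extendBallFun_apply_of_lt h (not_le.1 fun h' => hy (mem_closedBall_zero_iff.2 h'))

/-! ### §4 Ancel's Lemma 1 (2) in the unit ball -/

/-- **Ancel's Lemma 1 (2) inside the unit ball of `ℝⁿ`** (*"we can apply Lemma 1 in `Cᵢ - int Dᵢ`
to obtain a homeomorphism `λᵢ` [...] which restricts to the identity on `Dᵢ ∪ (∂Cᵢ)` such that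
[two countable nowhere dense sets] are separated"*): for an open `U ⊆ B(0, 1)` and countable
nowhere dense `S, T ⊆ U`, and `ε > 0`, there is a self-homeomorphism `h` of `E` which is
`ε`-close to the identity, the identity off `U`, and separates `h(S)` from `T`:
`cl h(S) ∩ T = ∅ = h(S) ∩ cl T`.  (Transport of `exists_homeomorph_separated_of_countable` on the
compact ball, extended by the identity.)
[cite: Ancel1984, Lemma 1 (2) (PDF p. 81) and proof of Lemma 3 (PDF p. 84)] -/
theorem exists_homeomorph_separated_of_countable_ball {U : Set E} (hU : IsOpen U)
    (hU1 : U ⊆ ball (0 : E) 1) {Sc Tc : Set E} (hSc : Sc.Countable) (hScU : Sc ⊆ U)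
    (hScnd : IsNowhereDense Sc) (hTc : Tc.Countable) (hTcU : Tc ⊆ U) (hTcnd : IsNowhereDense Tc)
    {ε : ℝ} (hε : 0 < ε) :
    ∃ h : E ≃ₜ E, (∀ y, dist y (h y) < ε) ∧ (∀ y, y ∉ U → h y = y) ∧
      Disjoint (closure (h '' Sc)) Tc ∧ Disjoint (h '' Sc) (closure Tc) := by
  set X := closedBall (0 : E) 1 with hX
  -- pull back to the compact ball
  set U' : Set X := Subtype.val ⁻¹' U with hU'
  have hU'o : IsOpen U' := hU.preimage continuous_subtype_val
  have hchart : ∀ p ∈ U', ∃ e : 𝔼 (Module.finrank ℝ E) → X,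
      Topology.IsOpenEmbedding e ∧ p ∈ range e := by
    rintro ⟨x, hx⟩ hxU
    exact exists_chart_closedBall (hU1 hxU)
  set Sc' : Set X := Subtype.val ⁻¹' Sc with hSc'
  set Tc' : Set X := Subtype.val ⁻¹' Tc with hTc'
  obtain ⟨h', hdist, hfix, hd1, hd2⟩ := exists_homeomorph_separated_of_countable hU'o hchart
    (hSc.preimage Subtype.val_injective) (preimage_mono hScU)
    (isNowhereDense_preimage_val_closedBall hScnd) (hTc.preimage Subtype.val_injective)
    (preimage_mono hTcU) (isNowhereDense_preimage_val_closedBall hTcnd) hε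
  -- `h'` fixes the sphere (it is the identity off `U' ⊆ B(0,1)`)
  have hsphere : ∀ p : X, ‖(p : E)‖ = 1 → h' p = p := fun p hp =>
    hfix p fun hpU => by
      have := mem_ball_zero_iff.1 (hU1 hpU)
      linarith
  set h := Homeomorph.extendSubtypeClosedBall h' hsphere with hh
  -- values
  have hval : ∀ y (hy : y ∈ X), h y = h' ⟨y, hy⟩ := fun y hy =>
    Homeomorph.extendSubtypeClosedBall_apply_of_mem h' hsphere hy
  have hScX : Sc ⊆ X := fun y hy => ball_subset_closedBall (hU1 (hScU hy))
  have hTcX : Tc ⊆ X := fun y hy => ball_subset_closedBall (hU1 (hTcU hy))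
  have himage : h '' Sc = Subtype.val '' (h' '' Sc') := by
    apply subset_antisymm
    · rintro _ ⟨y, hy, rfl⟩
      exact ⟨h' ⟨y, hScX hy⟩, ⟨⟨y, hScX hy⟩, hy, rfl⟩, (hval y _).symm⟩
    · rintro _ ⟨_, ⟨p, hp, rfl⟩, rfl⟩
      exact ⟨p, hp, (hval p.1 p.2).trans (by rfl)⟩
  refine ⟨h, fun y => ?_, fun y hy => ?_, ?_, ?_⟩
  · by_cases hy : y ∈ X
    · rw [hval y hy]
      have := hdist ⟨y, hy⟩
      rwa [Subtype.dist_eq] at this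
    · rw [hh, Homeomorph.extendSubtypeClosedBall_apply_of_not_mem h' hsphere hy, dist_self]
      exact hε
  · by_cases hy' : y ∈ X
    · rw [hval y hy', hfix ⟨y, hy'⟩ hy]
    · exact Homeomorph.extendSubtypeClosedBall_apply_of_not_mem h' hsphere hy'
  · -- `cl h(S) ∩ T = ∅`
    rw [himage, disjoint_left]
    rintro y hy hyT
    have hyX : y ∈ X := isClosed_closedBall.closure_subset_iff.2
      (image_subset_iff.2 fun p _ => p.2) hy
    have : (⟨y, hyX⟩ : X) ∈ closure (h' '' Sc') := by rw [closure_subtype]; exact hy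
    exact hd1.le_bot ⟨this, show (⟨y, hyX⟩ : X) ∈ Tc' from hyT⟩
  · -- `h(S) ∩ cl T = ∅`
    rw [himage, disjoint_left]
    rintro _ ⟨p, hp, rfl⟩ hpT
    have : p ∈ closure Tc' := by
      rw [closure_subtype, image_preimage_eq_of_subset (fun y hy => ⟨⟨y, hTcX hy⟩, rfl⟩)]
      exact hpT
    exact hd2.le_bot ⟨hp, this⟩

end Literature.Topology.FourManifolds

end
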